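import Literature.Topology.FourManifolds.ZeroSphereSurgeryModelDiscs
import Literature.Topology.FourManifolds.ImmersionOrientation
import Literature.Topology.FourManifolds.SmoothOrientationConnectedProofs
import Literature.Topology.FourManifolds.OrientedConnectedSumExistence
import Literature.Topology.FourManifolds.EntranceTransitionDet
import Literature.Geometry.Manifold.OpenSubmanifoldMFDeriv
import Mathlib.Geometry.Euclidean.Inversion.Calculus
import Mathlib.Analysis.Normed.Module.Connected
import HarnessLib

/-!
# The twisted `0`-surgery along the two standard discs is not orientable

Topic `Literature/Topology/FourManifolds`; piece F4 of the `S⁰`-surgery lemma (piece (2) of the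
roadmap of `OneHandlebodyBoundarySum.lean`, files `ZeroSphereSurgeryModel*.lean`): the TWISTED
standard position is excluded by orientability.

**Theorem** (`ZeroSphereModel.not_isOrientable_of_isOpenGluing_stdRel_twisted`).  Let `Z` be a
smooth `3`-manifold with a chart `Φ : Z ⇀ ℝ³` onto `ℝ³`, and let `Q` be an open gluing of
`A = Z ∖ {Φ⁻¹ c₊, Φ⁻¹ 0}` (`c₊ = nearCentre`) and the neck `D̊¹ × S²` along Milnor's identification
`stdRel (Φ⁻¹ ∘ discNear) (Φ⁻¹ ∘ discFar ∘ r)` written with the two standard discs of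
`ZeroSphereSurgeryModelDiscs.lean`, the far one precomposed with a linear isometry `r` of NEGATIVE
determinant.  Then `Q` is not orientable.

Proof (Kosinski 1993, VI §9; the orientation bookkeeping of Milnor 1965, §3): pull an orientation
of `Q` back (`SmoothOrientation.comapOfDetNeZero`) along the two local diffeomorphisms
`ψ = jA ∘ Φ⁻¹ : ℝ³ ∖ {c₊, 0} → Q` and `κ = jB ∘ σ : {0 < ‖z‖ < 2} → Q`, `σ z = ((‖z‖ - 1) e₁, z/‖z‖)`;
both domains are connected, so each pulled-back orientation is `±` the standard one, i.e. the
"character" `(o = std) ↔ (0 < det)` of `ψ`, resp. `κ`, is constant (§2).  On the outer shell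
`1 < ‖z‖ < 2` the gluing relation gives `κ = ψ ∘ discNear ∘ (-ι)` and on the punctured unit ball
`κ = ψ ∘ discFar ∘ r ∘ ι`, `ι v = (1 - ‖v‖) v/‖v‖` Kervaire–Milnor's disc inversion; comparing
characters, the Jacobian determinants of the two transition maps have the SAME sign (§2,
`sign_transfer`).  But they have OPPOSITE signs (§1): `discNear = β̂⁻¹ ∘ N ∘ (¼ ·)` with `N` a Möbius
inversion (`det < 0`, Mathlib's `EuclideanGeometry.hasFDerivAt_inversion`), `discFar = β̂⁻¹ ∘ farMob`
with `D(farMob)(0) = id/8` (`det > 0` near `0`), `det r < 0`, `det D(-ι) > 0 > det Dι` on the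
respective shells (`det Dι(v) = -((1 - ‖v‖)/‖v‖)²`), and the sign of `det D(β̂⁻¹)` is constant on the
connected `ℝ³` (it vanishes nowhere).  Everything here is proved; no definitions, no named facts.

## References

* A. A. Kosinski, *Differential Manifolds* (1993), VI §9. [Kosinski1993]
* J. Milnor, *Lectures on the h-cobordism theorem* (1965), §3. [MilnorHCobordism1965]
* M. Kervaire, J. Milnor, *Groups of homotopy spheres I*, Ann. Math. 77 (1963), §2. [KervaireMilnor1963]
* M. W. Hirsch, *Differential Topology* (1976), §4.4. [HirschDT1976]
-/

open scoped Manifold ContDiff Topology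
open Set Function Metric Module

noncomputable section

namespace Literature.Topology.FourManifolds

namespace ZeroSphereModel

open GluckUnknot (sphereProj coe_sphereProj sphereProj_smul_coe)
open Literature.Geometry.Manifold.OpenSubmanifold (mfderiv_subtype_val mdifferentiableAt_subtype_val)

universe u v

/-! ### §1 Jacobian determinants -/

/-- An injective endomorphism of `ℝ³` has nonzero determinant. [folklore] -/
theorem det_ne_zero_of_injective {L : EuclideanSpace ℝ (Fin 3) →L[ℝ] EuclideanSpace ℝ (Fin 3)}
    (hL : Injective L) : LinearMap.det (L : EuclideanSpace ℝ (Fin 3) →ₗ[ℝ] EuclideanSpace ℝ (Fin 3)) ≠ 0 := by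
  intro h
  have hk := LinearMap.det_eq_zero_iff_ker_ne_bot.1 h
  exact hk (LinearMap.ker_eq_bot.2 hL)

/-- **Jacobian of Kervaire–Milnor's disc inversion off the unit sphere**: at `v ≠ 0`, `‖v‖ ≠ 1`,
`det Dι(v) = -((1 - ‖v‖)/‖v‖)ⁿ⁻¹` (the tree's `det_fderiv_discInversionFun` without the restriction
`‖v‖ < 1`; eigenvalue `-1` on `ℝ v`, `(1 - ‖v‖)/‖v‖` on `v^⊥`). [cite: KervaireMilnor1963, §2] -/
theorem det_fderiv_discInversionFun_of_norm_ne_one {n : ℕ} (hn : n ≠ 0) {v : EuclideanSpace ℝ (Fin n)}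
    (hv : v ≠ 0) (hv1 : ‖v‖ ≠ 1) :
    LinearMap.det ((fderiv ℝ (discInversionFun : EuclideanSpace ℝ (Fin n) → EuclideanSpace ℝ (Fin n)) v :
      EuclideanSpace ℝ (Fin n) →L[ℝ] EuclideanSpace ℝ (Fin n)) :
        EuclideanSpace ℝ (Fin n) →ₗ[ℝ] EuclideanSpace ℝ (Fin n)) = -((1 - ‖v‖) * ‖v‖⁻¹) ^ (n - 1) := by
  have hn0 : ‖v‖ ≠ 0 := norm_ne_zero_iff.2 hv
  obtain ⟨g', hg'v, hd⟩ := exists_hasFDerivAt_discInversionFun hv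
  rw [hd.fderiv]
  set c : ℝ := (1 - ‖v‖) * ‖v‖⁻¹ with hc_def
  have hc : c ≠ 0 := mul_ne_zero (sub_ne_zero.2 (Ne.symm hv1)) (inv_ne_zero hn0)
  have hcoe : ((c • ContinuousLinearMap.id ℝ (EuclideanSpace ℝ (Fin n)) + g'.smulRight v :
      EuclideanSpace ℝ (Fin n) →L[ℝ] EuclideanSpace ℝ (Fin n)) :
      EuclideanSpace ℝ (Fin n) →ₗ[ℝ] EuclideanSpace ℝ (Fin n)) =
        c • LinearMap.id + (g' : EuclideanSpace ℝ (Fin n) →ₗ[ℝ] ℝ).smulRight v := by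
    ext w
    rfl
  rw [hcoe, det_smul_id_add_smulRight hn hc]
  have hg'v' : (g' : EuclideanSpace ℝ (Fin n) →ₗ[ℝ] ℝ) v = -‖v‖⁻¹ := hg'v
  rw [hg'v', hc_def]
  have : (1 - ‖v‖) * ‖v‖⁻¹ + -‖v‖⁻¹ = -1 := by field_simp; ring
  rw [this, mul_neg_one]

/-- `det (c • id) = c³` on `ℝ³`. [folklore] -/
theorem det_smul_id_clm (c : ℝ) :
    LinearMap.det ((c • ContinuousLinearMap.id ℝ (EuclideanSpace ℝ (Fin 3)) :
      EuclideanSpace ℝ (Fin 3) →L[ℝ] EuclideanSpace ℝ (Fin 3)) :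
        EuclideanSpace ℝ (Fin 3) →ₗ[ℝ] EuclideanSpace ℝ (Fin 3)) = c ^ 3 := by
  rw [ContinuousLinearMap.toLinearMap_smul, LinearMap.det_smul, ContinuousLinearMap.coe_id, LinearMap.det_id,
    finrank_euclideanSpace_fin, mul_one]

/-- `det (-D) = -det D` on `ℝ³`. [folklore] -/
theorem det_neg_clm (D : EuclideanSpace ℝ (Fin 3) →L[ℝ] EuclideanSpace ℝ (Fin 3)) :
    LinearMap.det ((-D : EuclideanSpace ℝ (Fin 3) →L[ℝ] EuclideanSpace ℝ (Fin 3)) :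
        EuclideanSpace ℝ (Fin 3) →ₗ[ℝ] EuclideanSpace ℝ (Fin 3)) =
      -LinearMap.det (D : EuclideanSpace ℝ (Fin 3) →ₗ[ℝ] EuclideanSpace ℝ (Fin 3)) := by
  rw [show (-D : EuclideanSpace ℝ (Fin 3) →L[ℝ] EuclideanSpace ℝ (Fin 3)) = (-1 : ℝ) • D from
    (neg_one_smul ℝ D).symm, ContinuousLinearMap.toLinearMap_smul, LinearMap.det_smul,
    finrank_euclideanSpace_fin]
  norm_num

/-- In `ℝ³` the Jacobian determinant of the disc inversion is NEGATIVE off the unit sphere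
(`= -((1 - ‖v‖)/‖v‖)²`). [cite: KervaireMilnor1963, §2] -/
theorem det_fderiv_discInversionFun_neg_three {v : EuclideanSpace ℝ (Fin 3)} (hv : v ≠ 0) (hv1 : ‖v‖ ≠ 1) :
    LinearMap.det ((fderiv ℝ (discInversionFun : EuclideanSpace ℝ (Fin 3) → EuclideanSpace ℝ (Fin 3)) v :
      EuclideanSpace ℝ (Fin 3) →L[ℝ] EuclideanSpace ℝ (Fin 3)) :
        EuclideanSpace ℝ (Fin 3) →ₗ[ℝ] EuclideanSpace ℝ (Fin 3)) < 0 := by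
  rw [det_fderiv_discInversionFun_of_norm_ne_one three_ne_zero hv hv1, neg_lt_zero]
  have hc : (1 - ‖v‖) * ‖v‖⁻¹ ≠ 0 :=
    mul_ne_zero (sub_ne_zero.2 (Ne.symm hv1)) (inv_ne_zero (norm_ne_zero_iff.2 hv))
  exact lt_of_le_of_ne (sq_nonneg _) (Ne.symm (pow_ne_zero 2 hc))

/-- The disc inversion is differentiable off the origin. [folklore] -/
theorem differentiableAt_discInversionFun {n : ℕ} {v : EuclideanSpace ℝ (Fin n)} (hv : v ≠ 0) :
    DifferentiableAt ℝ (discInversionFun : EuclideanSpace ℝ (Fin n) → EuclideanSpace ℝ (Fin n)) v := by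
  obtain ⟨g', -, hd⟩ := exists_hasFDerivAt_discInversionFun hv
  exact hd.differentiableAt

/-- **The Möbius map `N` is a sphere inversion** (minus the centre): `N x = inversion q 1 x - q`.
[folklore] -/
theorem mobN_eq_inversion_sub (x : EuclideanSpace ℝ (Fin 3)) :
    mobN x = EuclideanGeometry.inversion qPt 1 x - qPt := by
  rw [EuclideanGeometry.inversion, mobN, dist_eq_norm, vsub_eq_sub, vadd_eq_add, add_sub_cancel_right,
    one_div, inv_pow]

/-- **The Jacobian of the Möbius map `N` is negative** (off its pole `q`): its derivative is a
positive multiple of a hyperplane reflection (`EuclideanGeometry.hasFDerivAt_inversion`).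
[folklore] -/
theorem det_fderiv_mobN_neg {x : EuclideanSpace ℝ (Fin 3)} (hx : x ≠ qPt) :
    LinearMap.det ((fderiv ℝ mobN x : EuclideanSpace ℝ (Fin 3) →L[ℝ] EuclideanSpace ℝ (Fin 3)) :
      EuclideanSpace ℝ (Fin 3) →ₗ[ℝ] EuclideanSpace ℝ (Fin 3)) < 0 := by
  have hd : HasFDerivAt mobN ((1 / dist x qPt) ^ 2 •
      (((ℝ ∙ (x - qPt))ᗮ.reflection : EuclideanSpace ℝ (Fin 3) →L[ℝ] EuclideanSpace ℝ (Fin 3)))) x := by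
    have h := (EuclideanGeometry.hasFDerivAt_inversion (R := 1) hx).sub_const qPt
    have heq : (fun y => EuclideanGeometry.inversion qPt 1 y - qPt) = mobN :=
      funext fun y => (mobN_eq_inversion_sub y).symm
    rwa [heq] at h
  rw [hd.fderiv, ContinuousLinearMap.toLinearMap_smul, LinearMap.det_smul, finrank_euclideanSpace_fin]
  have hne : x - qPt ≠ 0 := sub_ne_zero.2 hx
  have hrefl : LinearMap.det (((ℝ ∙ (x - qPt))ᗮ.reflection : EuclideanSpace ℝ (Fin 3) →L[ℝ]
      EuclideanSpace ℝ (Fin 3)) : EuclideanSpace ℝ (Fin 3) →ₗ[ℝ] EuclideanSpace ℝ (Fin 3)) = -1 := by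
    have h1 := ((ℝ ∙ (x - qPt))ᗮ).det_reflection
    rw [Submodule.orthogonal_orthogonal, finrank_span_singleton hne, pow_one] at h1
    exact h1
  rw [hrefl, mul_neg_one, neg_lt_zero]
  have hdpos : 0 < dist x qPt := dist_pos.2 hx
  positivity

/-- **The Jacobian of `farMob` is positive near the origin** (`D(farMob)(0) = id/8` and the
Jacobian determinant is continuous). [folklore] -/
theorem eventually_det_fderiv_farMob_pos :
    ∀ᶠ x in 𝓝 (0 : EuclideanSpace ℝ (Fin 3)),
      0 < LinearMap.det ((fderiv ℝ farMob x : EuclideanSpace ℝ (Fin 3) →L[ℝ] EuclideanSpace ℝ (Fin 3)) :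
        EuclideanSpace ℝ (Fin 3) →ₗ[ℝ] EuclideanSpace ℝ (Fin 3)) := by
  have hc : ContDiffAt ℝ 1 farMob 0 := (contDiffAt_farMob (by norm_num)).of_le (by simp)
  have hf : ContinuousAt (fderiv ℝ farMob) 0 := (hc.fderiv_right (m := 0) le_rfl).continuousAt
  have hdet : ContinuousAt (fun x => (fderiv ℝ farMob x).det) 0 :=
    ContinuousLinearMap.continuous_det.continuousAt.comp hf
  have h0 : 0 < (fderiv ℝ farMob 0).det := by
    rw [hasFDerivAt_farMob_zero.fderiv, ContinuousLinearMap.det, ContinuousLinearMap.toLinearMap_smul,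
      ContinuousLinearMap.toLinearMap_smul, LinearMap.det_smul, LinearMap.det_smul, ContinuousLinearMap.coe_id,
      LinearMap.det_id, finrank_euclideanSpace_fin]
    norm_num
  exact hdet.eventually (Ioi_mem_nhds h0)

/-- **The Jacobian of the blow-down `β̂⁻¹` has constant sign**: it vanishes nowhere
(`injective_fderiv_blowDown`) and is continuous on the connected `ℝ³`. [folklore] -/
theorem det_fderiv_blowDown_mul_pos (w w' : EuclideanSpace ℝ (Fin 3)) :
    0 < LinearMap.det ((fderiv ℝ blowDown w : EuclideanSpace ℝ (Fin 3) →L[ℝ] EuclideanSpace ℝ (Fin 3)) :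
        EuclideanSpace ℝ (Fin 3) →ₗ[ℝ] EuclideanSpace ℝ (Fin 3)) *
      LinearMap.det ((fderiv ℝ blowDown w' : EuclideanSpace ℝ (Fin 3) →L[ℝ] EuclideanSpace ℝ (Fin 3)) :
        EuclideanSpace ℝ (Fin 3) →ₗ[ℝ] EuclideanSpace ℝ (Fin 3)) := by
  set f : EuclideanSpace ℝ (Fin 3) → ℝ := fun w => (fderiv ℝ blowDown w).det with hf
  have hfc : Continuous f :=
    ContinuousLinearMap.continuous_det.comp (contDiff_blowDown.continuous_fderiv (by simp))
  have hf0 : ∀ w, f w ≠ 0 := fun w => det_ne_zero_of_injective (injective_fderiv_blowDown w)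
  show 0 < f w * f w'
  rcases lt_or_gt_of_ne (hf0 w) with h | h <;> rcases lt_or_gt_of_ne (hf0 w') with h' | h'
  · exact mul_pos_of_neg_of_neg h h'
  · exfalso
    obtain ⟨c, hc⟩ := mem_range_of_exists_le_of_exists_ge hfc ⟨w, h.le⟩ ⟨w', h'.le⟩
    exact hf0 c hc
  · exfalso
    obtain ⟨c, hc⟩ := mem_range_of_exists_le_of_exists_ge hfc ⟨w', h'.le⟩ ⟨w, h.le⟩
    exact hf0 c hc
  · exact mul_pos h h'

/-! ### §2 Orientation characters of local diffeomorphisms from connected open subsets of `ℝ³` -/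

section Character

variable {Q : Type v} [TopologicalSpace Q] [ChartedSpace (EuclideanSpace ℝ (Fin 3)) Q]
  [IsManifold (𝓡 3) ∞ Q]

/-- **The orientation character of a local diffeomorphism from a connected open subset of `ℝ³`
into an oriented `3`-manifold is constant**: for `f : X → Q` smooth with nowhere vanishing
Jacobian (in the preferred charts) and `X ⊆ ℝ³` open and connected, the truth value of
"`o (f x)` is the standard orientation iff `det Df(x) > 0`" does not depend on `x` — the pulled
back orientation `f^* o` (`SmoothOrientation.comapOfDetNeZero`) is `±` the standard orientation of
the connected `X` (`eq_or_eq_neg_of_connectedSpace_holds`). [cite: HirschDT1976, §4.4 p. 101] -/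
theorem character_const {X : TopologicalSpace.Opens (EuclideanSpace ℝ (Fin 3))} [ConnectedSpace X]
    (o : SmoothOrientation (𝓡 3) Q) {f : X → Q} (hf : ContMDiff (𝓡 3) (𝓡 3) ∞ f)
    (hd : ∀ x, LinearMap.det (M := EuclideanSpace ℝ (Fin 3)) (mfderiv (𝓡 3) (𝓡 3) f x).toLinearMap ≠ 0) :
    (∀ x, (o (f x) = euclideanOrientation 3 ↔
        0 < LinearMap.det (M := EuclideanSpace ℝ (Fin 3)) (mfderiv (𝓡 3) (𝓡 3) f x).toLinearMap)) ∨
      (∀ x, ¬ (o (f x) = euclideanOrientation 3 ↔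
        0 < LinearMap.det (M := EuclideanSpace ℝ (Fin 3)) (mfderiv (𝓡 3) (𝓡 3) f x).toLinearMap)) := by
  set of := o.comapOfDetNeZero f hf (by simp) hd with hof
  have hne : euclideanOrientation 3 ≠ -euclideanOrientation 3 := Module.Ray.ne_neg_self _
  -- the pulled-back orientation is `±` the standard one
  have key : ∀ x, (of x = euclideanOrientation 3 ↔
      (o (f x) = euclideanOrientation 3 ↔
        0 < LinearMap.det (M := EuclideanSpace ℝ (Fin 3)) (mfderiv (𝓡 3) (𝓡 3) f x).toLinearMap)) := by
    intro x
    rw [hof, SmoothOrientation.comapOfDetNeZero_apply]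
    by_cases hp : 0 < LinearMap.det (M := EuclideanSpace ℝ (Fin 3)) (mfderiv (𝓡 3) (𝓡 3) f x).toLinearMap
    · rw [if_pos hp]
      exact ⟨fun h => ⟨fun _ => hp, fun _ => h⟩, fun h => h.2 hp⟩
    · rw [if_neg hp]
      constructor
      · intro h
        refine ⟨fun h' => ?_, fun h' => absurd h' hp⟩
        rw [h'] at h
        exact absurd h.symm hne
      · intro h
        have h1 : o (f x) ≠ euclideanOrientation 3 := fun h' => hp (h.1 h')
        rcases (o (f x)).eq_or_eq_neg (euclideanOrientation 3) (by simp) with h2 | h2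
        · exact absurd h2 h1
        · rw [h2]
          exact neg_neg (euclideanOrientation 3)
  rcases SmoothOrientation.eq_or_eq_neg_of_connectedSpace_holds
    ((SmoothOrientation.euclidean 3).restrict X) of with h | h
  · left
    intro x
    rw [← key x, h, SmoothOrientation.restrict_apply, SmoothOrientation.euclidean_apply]
  · right
    intro x
    rw [← key x, h]
    show ¬ (-(((SmoothOrientation.euclidean 3).restrict X) x) = euclideanOrientation 3)
    rw [SmoothOrientation.restrict_apply, SmoothOrientation.euclidean_apply]
    exact fun h' => hne h'.symm

end Character

/-- **Sign transfer**: if the characters at corresponding points agree iff `c`, and the Jacobian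
factors as `det κ = det ψ · ℓ` with `det ψ ≠ 0`, `ℓ ≠ 0`, then `0 < ℓ ↔ c`-combination; in the
form used below: `((P ↔ 0 < d ℓ) ↔ (P ↔ 0 < d)) ↔ 0 < ℓ`. [folklore] -/
theorem iff_iff_iff_pos (P : Prop) {d ℓ : ℝ} (hd : d ≠ 0) (hℓ : ℓ ≠ 0) :
    ((P ↔ 0 < d * ℓ) ↔ (P ↔ 0 < d)) ↔ 0 < ℓ := by
  have key : (0 < d * ℓ ↔ 0 < d) ↔ 0 < ℓ := by
    rcases lt_or_gt_of_ne hℓ with h | h <;> rcases lt_or_gt_of_ne hd with h1 | h1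
    · have h2 : 0 < d * ℓ := mul_pos_of_neg_of_neg h1 h
      exact ⟨fun h' => absurd (h'.1 h2) (not_lt.2 h1.le), fun h' => absurd h' (not_lt.2 h.le)⟩
    · have h2 : ¬ 0 < d * ℓ := not_lt.2 (mul_nonpos_of_nonneg_of_nonpos h1.le h.le)
      exact ⟨fun h' => absurd (h'.2 h1) h2, fun h' => absurd h' (not_lt.2 h.le)⟩
    · have h2 : ¬ 0 < d * ℓ := not_lt.2 (mul_nonpos_of_nonpos_of_nonneg h1.le h.le)
      exact ⟨fun _ => h, fun _ => ⟨fun h' => absurd h' h2, fun h' => absurd h' (not_lt.2 h1.le)⟩⟩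
    · exact ⟨fun _ => h, fun _ => ⟨fun _ => h1, fun _ => mul_pos h1 h⟩⟩
  rw [← key]
  tauto

/-! ### §3 Pieces of `ℝ³`: connectedness, and derivatives through open pieces -/

section Pieces

variable {Q : Type v} [TopologicalSpace Q] [ChartedSpace (EuclideanSpace ℝ (Fin 3)) Q]
  [IsManifold (𝓡 3) ∞ Q]

/-- `ℝ³` minus two points is connected (as an open submanifold). [folklore] -/
theorem connectedSpace_compl_pair (a b : EuclideanSpace ℝ (Fin 3))
    (U : TopologicalSpace.Opens (EuclideanSpace ℝ (Fin 3))) (hU : (U : Set (EuclideanSpace ℝ (Fin 3))) = {a, b}ᶜ) :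
    ConnectedSpace U := by
  have hrank : 1 < Module.rank ℝ (EuclideanSpace ℝ (Fin 3)) := by
    rw [← Module.finrank_eq_rank, finrank_euclideanSpace_fin]
    norm_num
  have h : IsConnected ((U : Set (EuclideanSpace ℝ (Fin 3)))) := by
    rw [hU]
    exact ((Set.toFinite ({a, b} : Set (EuclideanSpace ℝ (Fin 3)))).countable.isPathConnected_compl_of_one_lt_rank
      hrank).isConnected
  exact isConnected_iff_connectedSpace.1 h

/-- The punctured ball `{0 < ‖z‖ < 2}` of `ℝ³` is connected: it is the image of `S² × (0, 2)`
under `(u, t) ↦ t u`. [folklore] -/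
theorem connectedSpace_puncturedBall (S : TopologicalSpace.Opens (EuclideanSpace ℝ (Fin 3)))
    (hS : (S : Set (EuclideanSpace ℝ (Fin 3))) = {z | 0 < ‖z‖ ∧ ‖z‖ < 2}) : ConnectedSpace S := by
  have hrank : 1 < Module.rank ℝ (EuclideanSpace ℝ (Fin 3)) := by
    rw [← Module.finrank_eq_rank, finrank_euclideanSpace_fin]
    norm_num
  have himage : (fun p : EuclideanSpace ℝ (Fin 3) × ℝ => p.2 • p.1) ''
      (Metric.sphere (0 : EuclideanSpace ℝ (Fin 3)) 1 ×ˢ Ioo (0 : ℝ) 2) = {z | 0 < ‖z‖ ∧ ‖z‖ < 2} := by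
    ext z
    simp only [mem_image, mem_prod, mem_sphere_iff_norm, sub_zero, mem_Ioo, mem_setOf_eq, Prod.exists]
    constructor
    · rintro ⟨u, t, ⟨hu, ht0, ht2⟩, rfl⟩
      rw [norm_smul, Real.norm_of_nonneg ht0.le, hu, mul_one]
      exact ⟨ht0, ht2⟩
    · rintro ⟨h0, h2⟩
      refine ⟨‖z‖⁻¹ • z, ‖z‖, ⟨?_, h0, h2⟩, ?_⟩
      · rw [norm_smul, norm_inv, norm_norm, inv_mul_cancel₀ h0.ne']
      · rw [smul_smul, mul_inv_cancel₀ h0.ne', one_smul]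
  have h : IsConnected ((S : Set (EuclideanSpace ℝ (Fin 3)))) := by
    rw [hS, ← himage]
    exact ((isConnected_sphere hrank (0 : EuclideanSpace ℝ (Fin 3)) zero_le_one).prod
      (isConnected_Ioo (by norm_num : (0 : ℝ) < 2))).image _
      ((continuous_snd.smul continuous_fst).continuousOn)
  exact isConnected_iff_connectedSpace.1 h

omit [IsManifold (𝓡 3) ∞ Q] in
/-- **Chain rule through an open piece.**  If near `x₀ : X` (`X ⊆ ℝ³` open) the map `κ : X → Q`
factors as `κ x = ψ (T x)` through the open piece `Y ⊆ ℝ³` (`ψ : Y → Q` smooth, `T : ℝ³ → ℝ³`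
differentiable at `x₀` with `T x₀ ∈ Y`), then `Dκ(x₀) = Dψ(T x₀) ∘ DT(x₀)` in the preferred charts
(Lee 2013, Prop. 3.9: `T_p U = T_p M` for open `U`). [folklore] -/
theorem hasMFDerivAt_of_eventually_factor {X Y : TopologicalSpace.Opens (EuclideanSpace ℝ (Fin 3))}
    {κ : X → Q} {ψ : Y → Q} (hψ : ContMDiff (𝓡 3) (𝓡 3) ∞ ψ)
    {T : EuclideanSpace ℝ (Fin 3) → EuclideanSpace ℝ (Fin 3)} {z₀ : EuclideanSpace ℝ (Fin 3)}
    (hz₀ : z₀ ∈ X) (hT : DifferentiableAt ℝ T z₀) (hy₀ : T z₀ ∈ Y)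
    (h : ∀ᶠ x : X in 𝓝 ⟨z₀, hz₀⟩, ∃ hx : T x ∈ Y, κ x = ψ ⟨T x, hx⟩) :
    HasMFDerivAt (𝓡 3) (𝓡 3) κ ⟨z₀, hz₀⟩
      ((mfderiv (𝓡 3) (𝓡 3) ψ ⟨T z₀, hy₀⟩).comp (fderiv ℝ T z₀)) := by
  classical
  -- the corestricted transition map, extended by a junk value off the good set
  set τ : X → Y := fun x => if hx : T x ∈ Y then ⟨T x, hx⟩ else ⟨T z₀, hy₀⟩ with hτ
  have hτx₀ : τ ⟨z₀, hz₀⟩ = ⟨T z₀, hy₀⟩ := by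
    rw [hτ]
    dsimp only
    rw [dif_pos hy₀]
  have hmem : ∀ᶠ x : X in 𝓝 ⟨z₀, hz₀⟩, T x ∈ Y := by
    have hc : ContinuousAt (fun x : X => T x) ⟨z₀, hz₀⟩ :=
      hT.continuousAt.comp continuous_subtype_val.continuousAt
    exact hc.preimage_mem_nhds (Y.isOpen.mem_nhds hy₀)
  have hval : ∀ᶠ x : X in 𝓝 ⟨z₀, hz₀⟩, ((τ x : Y) : EuclideanSpace ℝ (Fin 3)) = T x := by
    filter_upwards [hmem] with x hx
    rw [hτ]
    dsimp only
    rw [dif_pos hx]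
  -- derivative of `τ`
  have hTval : HasMFDerivAt (𝓡 3) (𝓡 3) (T ∘ Subtype.val : X → EuclideanSpace ℝ (Fin 3)) ⟨z₀, hz₀⟩
      (fderiv ℝ T z₀) := by
    have h1 : HasMFDerivAt (𝓡 3) (𝓡 3) T z₀ (fderiv ℝ T z₀) :=
      hasMFDerivAt_iff_hasFDerivAt.2 hT.hasFDerivAt
    have h2 := Literature.Geometry.Manifold.OpenSubmanifold.hasMFDerivAt_subtype_val (I := 𝓡 3)
      (⟨z₀, hz₀⟩ : X)
    have h3 := h1.comp (⟨z₀, hz₀⟩ : X) h2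
    exact (ContinuousLinearMap.comp_id (fderiv ℝ T z₀)) ▸ h3
  have hτ' : HasMFDerivAt (𝓡 3) (𝓡 3) (fun x => ((τ x : Y) : EuclideanSpace ℝ (Fin 3))) ⟨z₀, hz₀⟩
      (fderiv ℝ T z₀) :=
    hTval.congr_of_eventuallyEq (hval.mono fun x hx => hx)
  have hτd : HasMFDerivAt (𝓡 3) (𝓡 3) τ ⟨z₀, hz₀⟩ (fderiv ℝ T z₀) :=
    hasMFDerivAt_codRestrict_opens (g := τ) (f := fun x => ((τ x : Y) : EuclideanSpace ℝ (Fin 3)))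
      (fun _ => rfl) hτ'
  -- chain rule and transfer to `κ`
  have hψd : MDifferentiableAt (𝓡 3) (𝓡 3) ψ (τ ⟨z₀, hz₀⟩) := (hψ _).mdifferentiableAt (by simp)
  have hcomp : HasMFDerivAt (𝓡 3) (𝓡 3) (ψ ∘ τ) ⟨z₀, hz₀⟩
      ((mfderiv (𝓡 3) (𝓡 3) ψ (τ ⟨z₀, hz₀⟩)).comp (fderiv ℝ T z₀)) :=
    hψd.hasMFDerivAt.comp (⟨z₀, hz₀⟩ : X) hτd
  rw [hτx₀] at hcomp
  refine hcomp.congr_of_eventuallyEq ?_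
  filter_upwards [h, hmem] with x hx hx'
  obtain ⟨hx, hκ⟩ := hx
  rw [Function.comp_apply, hκ, hτ]
  dsimp only
  rw [dif_pos hx']

/-- **The two transition maps have Jacobians of the same sign.**  Let `κ : X → Q`, `ψ : Y → Q` be
local diffeomorphisms (smooth, nowhere vanishing Jacobian) from CONNECTED open pieces of `ℝ³` into
an oriented `3`-manifold, and suppose `κ x₀ = ψ y₀`, `Dκ(x₀) = Dψ(y₀) ∘ L₀` and `κ x₁ = ψ y₁`,
`Dκ(x₁) = Dψ(y₁) ∘ L₁`.  Then `det L₀` and `det L₁` have the same sign: the orientation characters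
of `κ` and of `ψ` are constant (`character_const`). [cite: HirschDT1976, §4.4 p. 101] -/
theorem det_pos_iff_of_factor {X Y : TopologicalSpace.Opens (EuclideanSpace ℝ (Fin 3))}
    [ConnectedSpace X] [ConnectedSpace Y] (o : SmoothOrientation (𝓡 3) Q)
    {κ : X → Q} (hκ : ContMDiff (𝓡 3) (𝓡 3) ∞ κ)
    (hκd : ∀ x, LinearMap.det (M := EuclideanSpace ℝ (Fin 3)) (mfderiv (𝓡 3) (𝓡 3) κ x).toLinearMap ≠ 0)
    {ψ : Y → Q} (hψ : ContMDiff (𝓡 3) (𝓡 3) ∞ ψ)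
    (hψd : ∀ y, LinearMap.det (M := EuclideanSpace ℝ (Fin 3)) (mfderiv (𝓡 3) (𝓡 3) ψ y).toLinearMap ≠ 0)
    {x₀ x₁ : X} {y₀ y₁ : Y}
    {L₀ L₁ : EuclideanSpace ℝ (Fin 3) →L[ℝ] EuclideanSpace ℝ (Fin 3)}
    (h₀ : κ x₀ = ψ y₀) (h₀' : mfderiv (𝓡 3) (𝓡 3) κ x₀ = (mfderiv (𝓡 3) (𝓡 3) ψ y₀).comp L₀)
    (h₁ : κ x₁ = ψ y₁) (h₁' : mfderiv (𝓡 3) (𝓡 3) κ x₁ = (mfderiv (𝓡 3) (𝓡 3) ψ y₁).comp L₁) :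
    0 < LinearMap.det (L₀ : EuclideanSpace ℝ (Fin 3) →ₗ[ℝ] EuclideanSpace ℝ (Fin 3)) ↔
      0 < LinearMap.det (L₁ : EuclideanSpace ℝ (Fin 3) →ₗ[ℝ] EuclideanSpace ℝ (Fin 3)) := by
  -- constancy of the two characters
  obtain ⟨cκ, hcκ⟩ : ∃ c : Prop, ∀ x, ((o (κ x) = euclideanOrientation 3 ↔
      0 < LinearMap.det (M := EuclideanSpace ℝ (Fin 3)) (mfderiv (𝓡 3) (𝓡 3) κ x).toLinearMap) ↔ c) := by
    rcases character_const o hκ hκd with h | h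
    · exact ⟨True, fun x => iff_true_intro (h x)⟩
    · exact ⟨False, fun x => iff_false_intro (h x)⟩
  obtain ⟨cψ, hcψ⟩ : ∃ c : Prop, ∀ y, ((o (ψ y) = euclideanOrientation 3 ↔
      0 < LinearMap.det (M := EuclideanSpace ℝ (Fin 3)) (mfderiv (𝓡 3) (𝓡 3) ψ y).toLinearMap) ↔ c) := by
    rcases character_const o hψ hψd with h | h
    · exact ⟨True, fun y => iff_true_intro (h y)⟩
    · exact ⟨False, fun y => iff_false_intro (h y)⟩
  -- at each of the two points: `0 < det L ↔ (cκ ↔ cψ)`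
  have key : ∀ {x : X} {y : Y} {L : EuclideanSpace ℝ (Fin 3) →L[ℝ] EuclideanSpace ℝ (Fin 3)},
      κ x = ψ y → mfderiv (𝓡 3) (𝓡 3) κ x = (mfderiv (𝓡 3) (𝓡 3) ψ y).comp L →
      (0 < LinearMap.det (L : EuclideanSpace ℝ (Fin 3) →ₗ[ℝ] EuclideanSpace ℝ (Fin 3)) ↔ (cκ ↔ cψ)) := by
    intro x y L hxy hL
    have hdet : LinearMap.det (M := EuclideanSpace ℝ (Fin 3)) (mfderiv (𝓡 3) (𝓡 3) κ x).toLinearMap =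
        LinearMap.det (M := EuclideanSpace ℝ (Fin 3)) (mfderiv (𝓡 3) (𝓡 3) ψ y).toLinearMap *
          LinearMap.det (L : EuclideanSpace ℝ (Fin 3) →ₗ[ℝ] EuclideanSpace ℝ (Fin 3)) := by
      rw [hL]
      exact det_coe_comp_three _ _
    have hL0 : LinearMap.det (L : EuclideanSpace ℝ (Fin 3) →ₗ[ℝ] EuclideanSpace ℝ (Fin 3)) ≠ 0 := by
      intro h0
      apply hκd x
      rw [hdet, h0, mul_zero]
    have e1 := hcκ x
    have e2 := hcψ y
    rw [hxy, hdet] at e1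
    rw [← iff_iff_iff_pos (o (ψ y) = euclideanOrientation 3) (hψd y) hL0]
    constructor
    · intro h
      exact (e1.symm.trans h).trans e2
    · intro h
      exact (e1.trans h).trans e2.symm
  rw [key h₀ h₀', key h₁ h₁']

end Pieces

/-! ### §4 The chart side `ψ = jA ∘ Φ⁻¹` and the neck side `κ = jB ∘ σ` -/

section Sides

variable {Z : Type u} [TopologicalSpace Z] [ChartedSpace (EuclideanSpace ℝ (Fin 3)) Z]
  {Q : Type v} [TopologicalSpace Q] [ChartedSpace (EuclideanSpace ℝ (Fin 3)) Q]

/-- **A chart onto `ℝ³` with smooth inverse has nowhere vanishing Jacobian** (`Φ ∘ Φ⁻¹ = id` and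
the chain rule). [folklore] -/
theorem det_mfderiv_chart_symm_ne_zero (Φ : OpenPartialHomeomorph Z (EuclideanSpace ℝ (Fin 3)))
    (hΦt : Φ.target = univ) (hΦ : ContMDiffOn (𝓡 3) (𝓡 3) ∞ Φ Φ.source)
    (hΦ' : ContMDiff (𝓡 3) (𝓡 3) ∞ Φ.symm) (y : EuclideanSpace ℝ (Fin 3)) :
    LinearMap.det (M := EuclideanSpace ℝ (Fin 3)) (mfderiv (𝓡 3) (𝓡 3) Φ.symm y).toLinearMap ≠ 0 := by
  have hy : y ∈ Φ.target := hΦt ▸ mem_univ y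
  have hcomp : (Φ : Z → EuclideanSpace ℝ (Fin 3)) ∘ Φ.symm = id :=
    funext fun y' => Φ.right_inv (hΦt ▸ mem_univ y')
  have hΦd : MDifferentiableAt (𝓡 3) (𝓡 3) Φ (Φ.symm y) :=
    (hΦ.contMDiffAt (Φ.open_source.mem_nhds (Φ.map_target hy))).mdifferentiableAt (by simp)
  have hΦ'd : MDifferentiableAt (𝓡 3) (𝓡 3) Φ.symm y := (hΦ' y).mdifferentiableAt (by simp)
  have hchain := mfderiv_comp y hΦd hΦ'd
  rw [hcomp, mfderiv_id] at hchain
  exact right_ne_zero_of_mul_eq_one (det_mul_det_eq_one_of_comp_eq_id hchain.symm)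

/-- **The chart side `ψ = jA ∘ Φ⁻¹`** of the punctured chart is smooth with nowhere vanishing
Jacobian (`jA` an open smooth embedding, `det_mfderiv_ne_zero_of_isSmoothEmbedding`). [folklore] -/
theorem contMDiff_and_det_ne_zero_chartSide (Φ : OpenPartialHomeomorph Z (EuclideanSpace ℝ (Fin 3)))
    (hΦt : Φ.target = univ) (hΦ : ContMDiffOn (𝓡 3) (𝓡 3) ∞ Φ Φ.source)
    (hΦ' : ContMDiff (𝓡 3) (𝓡 3) ∞ Φ.symm) {A : TopologicalSpace.Opens Z} {jA : A → Q}
    (hjA : Manifold.IsSmoothEmbedding (𝓡 3) (𝓡 3) ∞ jA) (hjAo : IsOpen (range jA))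
    {U : TopologicalSpace.Opens (EuclideanSpace ℝ (Fin 3))} (hU : ∀ y : U, Φ.symm y ∈ A) :
    ContMDiff (𝓡 3) (𝓡 3) ∞ (fun y : U => jA ⟨Φ.symm y, hU y⟩) ∧
      ∀ y : U, LinearMap.det (M := EuclideanSpace ℝ (Fin 3))
        (mfderiv (𝓡 3) (𝓡 3) (fun y : U => jA ⟨Φ.symm y, hU y⟩) y).toLinearMap ≠ 0 := by
  set c : U → A := fun y => ⟨Φ.symm y, hU y⟩ with hc
  have hcval : ∀ y, (c y : Z) = (Φ.symm ∘ Subtype.val) y := fun _ => rfl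
  have hfs : ContMDiff (𝓡 3) (𝓡 3) ∞ (Φ.symm ∘ Subtype.val : U → Z) := hΦ'.comp contMDiff_subtype_val
  have hcs : ContMDiff (𝓡 3) (𝓡 3) ∞ c := (ContMDiff.subtypeVal_comp_iff A c).1 hfs
  refine ⟨hjA.contMDiff.comp hcs, fun y => ?_⟩
  have hjd : MDifferentiableAt (𝓡 3) (𝓡 3) jA (c y) := (hjA.contMDiff _).mdifferentiableAt (by simp)
  have h3 : HasMFDerivAt (𝓡 3) (𝓡 3) (Φ.symm ∘ Subtype.val : U → Z) y
      (mfderiv (𝓡 3) (𝓡 3) Φ.symm (y : EuclideanSpace ℝ (Fin 3))) := by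
    have h := ((hΦ' (y : EuclideanSpace ℝ (Fin 3))).mdifferentiableAt (by simp)).hasMFDerivAt.comp y
      (Literature.Geometry.Manifold.OpenSubmanifold.hasMFDerivAt_subtype_val (I := 𝓡 3) y)
    exact (ContinuousLinearMap.comp_id (mfderiv (𝓡 3) (𝓡 3) Φ.symm (y : EuclideanSpace ℝ (Fin 3)))) ▸ h
  have h4 : HasMFDerivAt (𝓡 3) (𝓡 3) (fun y : U => jA ⟨Φ.symm y, hU y⟩) y
      ((mfderiv (𝓡 3) (𝓡 3) jA (c y)).comp (mfderiv (𝓡 3) (𝓡 3) Φ.symm (y : EuclideanSpace ℝ (Fin 3)))) :=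
    hjd.hasMFDerivAt.comp y (hasMFDerivAt_codRestrict_opens (g := c) hcval h3)
  rw [h4.mfderiv]
  intro h0
  exact mul_ne_zero (det_mfderiv_ne_zero_of_isSmoothEmbedding hjA hjAo (c y))
    (det_mfderiv_chart_symm_ne_zero Φ hΦt hΦ hΦ' y) ((det_coe_comp_three _ _).symm.trans h0)

/-- **The neck side `κ = jB ∘ σ`**, `σ z = ((), (‖z‖ - 1) e₁, z/‖z‖)` on the punctured ball
`{0 < ‖z‖ < 2}`, is smooth with nowhere vanishing Jacobian: `σ` is smooth with injective differential
(it has the smooth left inverse `((), τ e₁, u) ↦ (τ + 1) u`) and `jB` is an immersion. [folklore] -/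
theorem contMDiff_and_det_ne_zero_neckSide {jB : ↥(ballTimesSphere Unit 0 2) → Q}
    (hjB : Manifold.IsSmoothEmbedding ((𝓡 0).prod ((𝓡 1).prod (𝓡 2))) (𝓡 3) ∞ jB)
    {S : TopologicalSpace.Opens (EuclideanSpace ℝ (Fin 3))} (hS : ∀ z : S, (z : EuclideanSpace ℝ (Fin 3)) ≠ 0)
    (σ : S → ↥(ballTimesSphere Unit 0 2))
    (hσ : ∀ z, (σ z : NeckAmbient) =
      (DiscreteIndex.mk (), (‖(z : EuclideanSpace ℝ (Fin 3))‖ - 1) • e1, sphereProj (z : EuclideanSpace ℝ (Fin 3)))) :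
    ContMDiff (𝓡 3) (𝓡 3) ∞ (jB ∘ σ) ∧
      ∀ z : S, LinearMap.det (M := EuclideanSpace ℝ (Fin 3))
        (mfderiv (𝓡 3) (𝓡 3) (jB ∘ σ) z).toLinearMap ≠ 0 := by
  haveI : Fact (Module.finrank ℝ (EuclideanSpace ℝ (Fin 3)) = 2 + 1) := ⟨by simp⟩
  -- smoothness of `σ`
  have hF : ContMDiff (𝓡 3) ((𝓡 0).prod ((𝓡 1).prod (𝓡 2))) ∞ (Subtype.val ∘ σ) := by
    have heq : Subtype.val ∘ σ = fun z : S =>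
        ((DiscreteIndex.mk (), (‖(z : EuclideanSpace ℝ (Fin 3))‖ - 1) • e1,
          sphereProj (z : EuclideanSpace ℝ (Fin 3))) : NeckAmbient) := funext hσ
    rw [heq]
    have h1 : ContMDiffOn (𝓡 3) (𝓡 1) ∞ (fun z : EuclideanSpace ℝ (Fin 3) => (‖z‖ - 1) • e1) {z | z ≠ 0} :=
      fun z hz => (((contDiffAt_norm ℝ hz).sub contDiffAt_const).smul contDiffAt_const).contMDiffAt.contMDiffWithinAt
    have h1' : ContMDiff (𝓡 3) (𝓡 1) ∞ (fun z : S => (‖(z : EuclideanSpace ℝ (Fin 3))‖ - 1) • e1) :=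
      h1.comp_contMDiff contMDiff_subtype_val fun z => hS z
    have h2' : ContMDiff (𝓡 3) (𝓡 2) ∞ (fun z : S => sphereProj (z : EuclideanSpace ℝ (Fin 3))) :=
      contMDiffOn_sphereProj.comp_contMDiff contMDiff_subtype_val fun z => hS z
    exact contMDiff_const.prodMk (h1'.prodMk h2')
  have hσs : ContMDiff (𝓡 3) ((𝓡 0).prod ((𝓡 1).prod (𝓡 2))) ∞ σ :=
    (ContMDiff.subtypeVal_comp_iff (ballTimesSphere Unit 0 2) σ).1 hF
  refine ⟨hjB.contMDiff.comp hσs, fun z => ?_⟩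
  -- the smooth left inverse `λ ((), τ e₁, u) = (τ 0 + 1) u` of `σ`
  set lam : ↥(ballTimesSphere Unit 0 2) → EuclideanSpace ℝ (Fin 3) :=
    fun b => ((b : NeckAmbient).2.1 0 + 1) • ((b : NeckAmbient).2.2 : EuclideanSpace ℝ (Fin 3)) with hlam
  have hlams : ContMDiff ((𝓡 0).prod ((𝓡 1).prod (𝓡 2))) (𝓡 3) ∞ lam := by
    have h1 : ContMDiff ((𝓡 0).prod ((𝓡 1).prod (𝓡 2))) 𝓘(ℝ, ℝ) ∞
        (fun b : ↥(ballTimesSphere Unit 0 2) => (b : NeckAmbient).2.1 0 + 1) := by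
      refine ContMDiff.add ?_ contMDiff_const
      exact (EuclideanSpace.proj (0 : Fin 1) : EuclideanSpace ℝ (Fin 1) →L[ℝ] ℝ).contMDiff.comp
        (contMDiff_fst.comp (contMDiff_snd.comp contMDiff_subtype_val))
    have h2 : ContMDiff ((𝓡 0).prod ((𝓡 1).prod (𝓡 2))) 𝓘(ℝ, EuclideanSpace ℝ (Fin 3)) ∞
        (fun b : ↥(ballTimesSphere Unit 0 2) => ((b : NeckAmbient).2.2 : EuclideanSpace ℝ (Fin 3))) :=
      contMDiff_coe_sphere.comp (contMDiff_snd.comp (contMDiff_snd.comp contMDiff_subtype_val))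
    exact h1.smul h2
  have hleft : lam ∘ σ = Subtype.val := by
    funext z
    have hz := hS z
    have hn : (0 : ℝ) < ‖(z : EuclideanSpace ℝ (Fin 3))‖ := norm_pos_iff.2 hz
    simp only [Function.comp_apply, hlam, hσ]
    rw [PiLp.smul_apply, e1_apply_zero, smul_eq_mul, mul_one, sub_add_cancel]
    exact norm_smul_coe_sphereProj hz
  have hσd : MDifferentiableAt (𝓡 3) ((𝓡 0).prod ((𝓡 1).prod (𝓡 2))) σ z := (hσs z).mdifferentiableAt (by simp)
  have hlamd : MDifferentiableAt ((𝓡 0).prod ((𝓡 1).prod (𝓡 2))) (𝓡 3) lam (σ z) :=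
    (hlams _).mdifferentiableAt (by simp)
  have hjd : MDifferentiableAt ((𝓡 0).prod ((𝓡 1).prod (𝓡 2))) (𝓡 3) jB (σ z) :=
    (hjB.contMDiff _).mdifferentiableAt (by simp)
  have hchain := mfderiv_comp z hlamd hσd
  rw [hleft, mfderiv_subtype_val] at hchain
  have hinjσ : Injective (mfderiv (𝓡 3) ((𝓡 0).prod ((𝓡 1).prod (𝓡 2))) σ z) := fun v w hvw => by
    have := congrArg (mfderiv ((𝓡 0).prod ((𝓡 1).prod (𝓡 2))) (𝓡 3) lam (σ z)) hvw
    rw [← ContinuousLinearMap.comp_apply, ← ContinuousLinearMap.comp_apply, ← hchain] at this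
    exact this
  rw [mfderiv_comp z hjd hσd]
  exact det_ne_zero_of_injective
    ((injective_mfderiv_of_isImmersionAt' (hjB.isImmersion.isImmersionAt (σ z))).comp hinjσ)

end Sides

/-! ### §5 The twisted standard position is not orientable -/

/-- **The twisted `0`-surgery is not orientable.**  Let `Φ : Z ⇀ ℝ³` be a chart of the smooth
`3`-manifold `Z` onto `ℝ³` with smooth inverse, `r` a linear isometry of `ℝ³` with `det r < 0`, and
`Q` an open gluing of `A = Z ∖ {Φ⁻¹ c₊, Φ⁻¹ 0}` and the neck `D̊¹ × S²` along Milnor's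
identification `stdRel (Φ⁻¹ ∘ discNear) (Φ⁻¹ ∘ discFar ∘ r)` (the near foot read through the
standard near disc, the far foot through the REFLECTED standard far disc).  Then `Q` carries no
smooth orientation: the two transition maps between the neck coordinate `z ↦ ((‖z‖ - 1) e₁, z/‖z‖)`
and the chart have Jacobians of the same sign by the orientation-character argument
(`det_pos_iff_of_factor`), and of opposite signs by the explicit computation (§1).
[cite: Kosinski1993, VI §9] [cite: MilnorHCobordism1965, §3] -/
theorem not_isOrientable_of_isOpenGluing_stdRel_twisted
    {Z : Type u} [TopologicalSpace Z] [T2Space Z] [ChartedSpace (EuclideanSpace ℝ (Fin 3)) Z]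
    [IsManifold (𝓡 3) ∞ Z]
    (Φ : OpenPartialHomeomorph Z (EuclideanSpace ℝ (Fin 3))) (hΦt : Φ.target = univ)
    (hΦ : ContMDiffOn (𝓡 3) (𝓡 3) ∞ Φ Φ.source) (hΦ' : ContMDiff (𝓡 3) (𝓡 3) ∞ Φ.symm)
    {Q : Type v} [TopologicalSpace Q] [T2Space Q] [ChartedSpace (EuclideanSpace ℝ (Fin 3)) Q]
    [IsManifold (𝓡 3) ∞ Q]
    (r : EuclideanSpace ℝ (Fin 3) ≃ₗᵢ[ℝ] EuclideanSpace ℝ (Fin 3))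
    (hr : LinearMap.det (r.toLinearEquiv : EuclideanSpace ℝ (Fin 3) →ₗ[ℝ] EuclideanSpace ℝ (Fin 3)) < 0)
    {A : TopologicalSpace.Opens Z}
    (hA : (A : Set Z) = ({Φ.symm nearCentre, Φ.symm 0} : Set Z)ᶜ)
    (hG : IsOpenGluing (𝓡 3) ((𝓡 0).prod ((𝓡 1).prod (𝓡 2))) (𝓡 3)
      (A := ↥A) (B := ↥(ballTimesSphere Unit 0 2)) (P := Q)
      (stdRel (Φ.symm ∘ discNear) (Φ.symm ∘ discFar ∘ r)))
    (ho : IsOrientable (𝓡 3) Q) : False := by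
  obtain ⟨o⟩ := ho
  obtain ⟨jA, jB, hjA, hjAo, hjB, -, -, hR⟩ := hG
  /- §A the chart side `ψ = jA ∘ Φ⁻¹` on `U = ℝ³ ∖ {c₊, 0}` -/
  have hΦinj : Injective Φ.symm := by
    intro a b h
    have ha : a ∈ Φ.symm.source := by rw [Φ.symm_source, hΦt]; exact mem_univ a
    have hb : b ∈ Φ.symm.source := by rw [Φ.symm_source, hΦt]; exact mem_univ b
    exact Φ.symm.injOn ha hb h
  let U : TopologicalSpace.Opens (EuclideanSpace ℝ (Fin 3)) :=
    ⟨({nearCentre, 0} : Set (EuclideanSpace ℝ (Fin 3)))ᶜ, (Set.toFinite _).isClosed.isOpen_compl⟩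
  have hUmem : ∀ {y : EuclideanSpace ℝ (Fin 3)}, y ∈ U ↔ y ≠ nearCentre ∧ y ≠ 0 := fun {y} => by
    show y ∈ ({nearCentre, 0} : Set (EuclideanSpace ℝ (Fin 3)))ᶜ ↔ _
    rw [mem_compl_iff, mem_insert_iff, mem_singleton_iff, not_or]
  have hUA : ∀ y : U, Φ.symm y ∈ A := fun y => by
    obtain ⟨h1, h2⟩ := hUmem.1 y.2
    rw [← SetLike.mem_coe, hA, mem_compl_iff, mem_insert_iff, mem_singleton_iff, hΦinj.eq_iff,
      hΦinj.eq_iff, not_or]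
    exact ⟨h1, h2⟩
  set ψ : U → Q := fun y => jA ⟨Φ.symm y, hUA y⟩ with hψ_def
  obtain ⟨hψs, hψd⟩ : ContMDiff (𝓡 3) (𝓡 3) ∞ ψ ∧ ∀ y : U, LinearMap.det (M := EuclideanSpace ℝ (Fin 3))
      (mfderiv (𝓡 3) (𝓡 3) ψ y).toLinearMap ≠ 0 :=
    contMDiff_and_det_ne_zero_chartSide Φ hΦt hΦ hΦ' hjA hjAo hUA
  haveI : ConnectedSpace U := connectedSpace_compl_pair nearCentre 0 U rfl
  /- §B the neck side `κ = jB ∘ σ` on the punctured ball `S = {0 < ‖z‖ < 2}` -/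
  let S : TopologicalSpace.Opens (EuclideanSpace ℝ (Fin 3)) :=
    ⟨{z | 0 < ‖z‖ ∧ ‖z‖ < 2},
      (isOpen_lt continuous_const continuous_norm).inter (isOpen_lt continuous_norm continuous_const)⟩
  have hSmem : ∀ {z : EuclideanSpace ℝ (Fin 3)}, z ∈ S ↔ 0 < ‖z‖ ∧ ‖z‖ < 2 := Iff.rfl
  have hS0 : ∀ z : S, (z : EuclideanSpace ℝ (Fin 3)) ≠ 0 := fun z => norm_pos_iff.1 (hSmem.1 z.2).1
  have hSB : ∀ z : S, ((DiscreteIndex.mk (), (‖(z : EuclideanSpace ℝ (Fin 3))‖ - 1) • e1,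
      sphereProj (z : EuclideanSpace ℝ (Fin 3))) : NeckAmbient) ∈ ballTimesSphere Unit 0 2 := fun z => by
    obtain ⟨h1, h2⟩ := hSmem.1 z.2
    rw [mem_ballTimesSphere_iff]
    show ‖(‖(z : EuclideanSpace ℝ (Fin 3))‖ - 1) • e1‖ < 1
    rw [norm_smul_e1, abs_sub_lt_iff]
    constructor <;> linarith
  set σ : S → ↥(ballTimesSphere Unit 0 2) := fun z => ⟨_, hSB z⟩ with hσ_def
  have hσ : ∀ z, (σ z : NeckAmbient) = (DiscreteIndex.mk (), (‖(z : EuclideanSpace ℝ (Fin 3))‖ - 1) • e1,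
      sphereProj (z : EuclideanSpace ℝ (Fin 3))) := fun z => rfl
  obtain ⟨hκs, hκd⟩ := contMDiff_and_det_ne_zero_neckSide hjB hS0 σ hσ
  haveI : ConnectedSpace S := connectedSpace_puncturedBall S rfl
  /- §C the transition maps and the gluing relation -/
  -- `ι z = 0` iff `‖z‖ = 1` (for `z ≠ 0`)
  have hι0 : ∀ {z : EuclideanSpace ℝ (Fin 3)}, z ≠ 0 → ‖z‖ ≠ 1 → discInversionFun z ≠ 0 := by
    intro z hz hz1 h
    rw [discInversionFun, smul_eq_zero] at h
    rcases h with h | h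
    · rcases mul_eq_zero.1 h with h | h
      · exact hz1 (sub_eq_zero.1 h).symm
      · exact norm_ne_zero_iff.2 hz (inv_eq_zero.1 h)
    · exact hz h
  -- polar form of the disc inversion on `S`
  have hιpol : ∀ z : S, discInversionFun (z : EuclideanSpace ℝ (Fin 3)) =
      (1 - ‖(z : EuclideanSpace ℝ (Fin 3))‖) • (sphereProj (z : EuclideanSpace ℝ (Fin 3)) : EuclideanSpace ℝ (Fin 3)) := by
    intro z
    have hz := hS0 z
    have hn : (0 : ℝ) < ‖(z : EuclideanSpace ℝ (Fin 3))‖ := norm_pos_iff.2 hz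
    have hu : ‖(z : EuclideanSpace ℝ (Fin 3))‖⁻¹ • (z : EuclideanSpace ℝ (Fin 3)) =
        (sphereProj (z : EuclideanSpace ℝ (Fin 3)) : EuclideanSpace ℝ (Fin 3)) := by
      rw [inv_smul_eq_iff₀ hn.ne', norm_smul_coe_sphereProj hz]
    rw [discInversionFun, mul_smul, hu]
  -- the near transition map `T₀ = discNear ∘ (-ι)` and the far one `T₁ = discFar ∘ r ∘ ι` land in `U`
  have hT₀U : ∀ {z : EuclideanSpace ℝ (Fin 3)}, z ≠ 0 → ‖z‖ ≠ 1 → discNear (-discInversionFun z) ∈ U := by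
    intro z hz hz1
    refine hUmem.2 ⟨fun h => ?_, fun h => ?_⟩
    · rw [← discNear_zero] at h
      exact hι0 hz hz1 (neg_eq_zero.1 (discNear_injective h))
    · rw [← discFar_zero] at h
      exact Set.disjoint_left.1 disjoint_range_discNear_discFar (mem_range_self _) ⟨0, h.symm⟩
  have hT₁U : ∀ {z : EuclideanSpace ℝ (Fin 3)}, z ≠ 0 → ‖z‖ ≠ 1 → discFar (r (discInversionFun z)) ∈ U := by
    intro z hz hz1
    refine hUmem.2 ⟨fun h => ?_, fun h => ?_⟩
    · rw [← discNear_zero] at h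
      exact Set.disjoint_left.1 disjoint_range_discNear_discFar (mem_range_self 0) ⟨_, h⟩
    · rw [← discFar_zero] at h
      have h' : r (discInversionFun z) = 0 := discFar_injective h
      exact hι0 hz hz1 (r.injective (h'.trans (map_zero r).symm))
  -- the gluing relation on the outer shell and on the punctured unit ball
  have hrel₀ : ∀ (z : S) (hz1 : 1 < ‖(z : EuclideanSpace ℝ (Fin 3))‖),
      (jB ∘ σ) z = ψ ⟨discNear (-discInversionFun (z : EuclideanSpace ℝ (Fin 3))), hT₀U (hS0 z) hz1.ne'⟩ := by
    intro z hz1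
    have h2 := (hSmem.1 z.2).2
    refine ((hR _ (σ z)).2 ⟨‖(z : EuclideanSpace ℝ (Fin 3))‖ - 1, ⟨by linarith, by linarith⟩, Or.inl ⟨rfl, ?_⟩⟩).symm
    show Φ.symm (discNear (-discInversionFun (z : EuclideanSpace ℝ (Fin 3)))) =
      Φ.symm (discNear ((‖(z : EuclideanSpace ℝ (Fin 3))‖ - 1) •
        (sphereProj (z : EuclideanSpace ℝ (Fin 3)) : EuclideanSpace ℝ (Fin 3))))
    rw [hιpol z, ← neg_smul, neg_sub]
  have hrel₁ : ∀ (z : S) (hz1 : ‖(z : EuclideanSpace ℝ (Fin 3))‖ < 1),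
      (jB ∘ σ) z = ψ ⟨discFar (r (discInversionFun (z : EuclideanSpace ℝ (Fin 3)))), hT₁U (hS0 z) hz1.ne⟩ := by
    intro z hz1
    have h1 := (hSmem.1 z.2).1
    refine ((hR _ (σ z)).2 ⟨1 - ‖(z : EuclideanSpace ℝ (Fin 3))‖, ⟨by linarith, by linarith⟩, Or.inr ⟨?_, ?_⟩⟩).symm
    · show (‖(z : EuclideanSpace ℝ (Fin 3))‖ - 1) • e1 = (-(1 - ‖(z : EuclideanSpace ℝ (Fin 3))‖)) • e1
      rw [neg_sub]
    · show Φ.symm (discFar (r (discInversionFun (z : EuclideanSpace ℝ (Fin 3))))) =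
        Φ.symm (discFar (r ((1 - ‖(z : EuclideanSpace ℝ (Fin 3))‖) •
          (sphereProj (z : EuclideanSpace ℝ (Fin 3)) : EuclideanSpace ℝ (Fin 3)))))
      rw [hιpol z]
  /- §D the two base points and the factorisations of `Dκ` -/
  set u₀ : EuclideanSpace ℝ (Fin 3) := EuclideanSpace.single 0 1 with hu₀_def
  have hu₀ : ‖u₀‖ = 1 := by simp [hu₀_def]
  -- a radius below which `D(farMob)` has positive Jacobian
  obtain ⟨δ, hδ, hfar⟩ := Metric.eventually_nhds_iff.1 eventually_det_fderiv_farMob_pos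
  set δ' : ℝ := min δ 1 / 2 with hδ'
  have hδ'pos : 0 < δ' := by rw [hδ']; positivity
  have hδ'le : δ' ≤ 1 / 2 := by rw [hδ']; linarith [min_le_right δ 1]
  have hδ'lt : δ' < δ := by rw [hδ']; linarith [min_le_left δ 1]
  -- the base points `z₀ = (3/2) u₀` (outer shell) and `z₁ = (1 - δ') u₀` (punctured unit ball)
  set z₀ : EuclideanSpace ℝ (Fin 3) := (3 / 2 : ℝ) • u₀ with hz₀_def
  set z₁ : EuclideanSpace ℝ (Fin 3) := (1 - δ') • u₀ with hz₁_def
  have hnz₀ : ‖z₀‖ = 3 / 2 := by rw [hz₀_def, norm_smul, hu₀, mul_one]; norm_num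
  have hnz₁ : ‖z₁‖ = 1 - δ' := by
    rw [hz₁_def, norm_smul, hu₀, mul_one, Real.norm_of_nonneg (by linarith)]
  have hz₀S : z₀ ∈ S := hSmem.2 ⟨by rw [hnz₀]; norm_num, by rw [hnz₀]; norm_num⟩
  have hz₁S : z₁ ∈ S := hSmem.2 ⟨by rw [hnz₁]; linarith, by rw [hnz₁]; linarith⟩
  have hz₀0 : z₀ ≠ 0 := norm_pos_iff.1 (by rw [hnz₀]; norm_num)
  have hz₁0 : z₁ ≠ 0 := norm_pos_iff.1 (by rw [hnz₁]; linarith)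
  have hz₀1 : ‖z₀‖ ≠ 1 := by rw [hnz₀]; norm_num
  have hz₁1 : ‖z₁‖ ≠ 1 := by rw [hnz₁]; linarith
  have hι₀ : discInversionFun z₀ = (-(1 / 2 : ℝ)) • u₀ := by
    rw [hz₀_def, discInversionFun_smul hu₀ (by norm_num)]; norm_num
  have hι₁ : discInversionFun z₁ = δ' • u₀ := by
    rw [hz₁_def, discInversionFun_smul hu₀ (by linarith)]; congr 1; ring
  -- differentiability of the transition maps at the base points
  have hT₀d : DifferentiableAt ℝ (fun z => discNear (-discInversionFun z)) z₀ :=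
    (contDiff_discNear.differentiable (by simp)).differentiableAt.comp z₀
      (differentiableAt_discInversionFun hz₀0).neg
  have hT₁d : DifferentiableAt ℝ (fun z => discFar (r (discInversionFun z))) z₁ :=
    (contDiff_discFar.differentiable (by simp)).differentiableAt.comp z₁
      ((r.toContinuousLinearEquiv.differentiableAt).comp z₁ (differentiableAt_discInversionFun hz₁0))
  -- the factorisations hold near the base points
  have hev₀ : ∀ᶠ x : S in 𝓝 ⟨z₀, hz₀S⟩, ∃ hx : discNear (-discInversionFun (x : EuclideanSpace ℝ (Fin 3))) ∈ U,
      (jB ∘ σ) x = ψ ⟨discNear (-discInversionFun (x : EuclideanSpace ℝ (Fin 3))), hx⟩ := by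
    have hopen : IsOpen {x : S | 1 < ‖(x : EuclideanSpace ℝ (Fin 3))‖} :=
      isOpen_lt continuous_const (continuous_norm.comp continuous_subtype_val)
    filter_upwards [hopen.mem_nhds (show (1 : ℝ) < ‖z₀‖ by rw [hnz₀]; norm_num)] with x hx
    exact ⟨hT₀U (hS0 x) (ne_of_gt hx), hrel₀ x hx⟩
  have hev₁ : ∀ᶠ x : S in 𝓝 ⟨z₁, hz₁S⟩, ∃ hx : discFar (r (discInversionFun (x : EuclideanSpace ℝ (Fin 3)))) ∈ U,
      (jB ∘ σ) x = ψ ⟨discFar (r (discInversionFun (x : EuclideanSpace ℝ (Fin 3)))), hx⟩ := by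
    have hopen : IsOpen {x : S | ‖(x : EuclideanSpace ℝ (Fin 3))‖ < 1} :=
      isOpen_lt (continuous_norm.comp continuous_subtype_val) continuous_const
    filter_upwards [hopen.mem_nhds (show ‖z₁‖ < (1 : ℝ) by rw [hnz₁]; linarith)] with x hx
    exact ⟨hT₁U (hS0 x) (ne_of_lt hx), hrel₁ x hx⟩
  have H₀ := hasMFDerivAt_of_eventually_factor (κ := jB ∘ σ) hψs hz₀S hT₀d (hT₀U hz₀0 hz₀1) hev₀
  have H₁ := hasMFDerivAt_of_eventually_factor (κ := jB ∘ σ) hψs hz₁S hT₁d (hT₁U hz₁0 hz₁1) hev₁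
  -- same sign of the two Jacobians
  have hiff := det_pos_iff_of_factor o hκs hκd hψs hψd
    (hrel₀ ⟨z₀, hz₀S⟩ (by rw [hnz₀]; norm_num)) H₀.mfderiv (hrel₁ ⟨z₁, hz₁S⟩ (by rw [hnz₁]; linarith)) H₁.mfderiv
  /- §E the explicit Jacobians: opposite signs -/
  -- the near transition map: `T₀ = β̂⁻¹ ∘ N ∘ (¼ ·) ∘ (-ι)` near `z₀`
  have hD₀ := (differentiableAt_discInversionFun hz₀0).hasFDerivAt
  have hx₀' : -discInversionFun z₀ = (1 / 2 : ℝ) • u₀ := by rw [hι₀, neg_smul, neg_neg]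
  have hnx₀' : ‖-discInversionFun z₀‖ = 1 / 2 := by
    rw [hx₀', norm_smul, hu₀, mul_one]; norm_num
  have hv₀q : (4 : ℝ)⁻¹ • (-discInversionFun z₀) ≠ qPt := by
    intro h
    have h' := congrArg norm h
    rw [norm_smul, hnx₀', norm_qPt] at h'
    norm_num at h'
  have hsc : HasFDerivAt (fun x : EuclideanSpace ℝ (Fin 3) => (4 : ℝ)⁻¹ • x)
      ((4 : ℝ)⁻¹ • ContinuousLinearMap.id ℝ (EuclideanSpace ℝ (Fin 3))) (-discInversionFun z₀) := by
    have h := (hasFDerivAt_id (𝕜 := ℝ) (-discInversionFun z₀)).const_smul ((4 : ℝ)⁻¹)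
    simpa only [Pi.smul_def, id] using h
  have hN₀ := ((contDiffAt_mobN hv₀q).differentiableAt (by simp)).hasFDerivAt
  have hβ₀ := ((contDiff_blowDown.differentiable (by simp)) (mobN ((4 : ℝ)⁻¹ • (-discInversionFun z₀)))).hasFDerivAt
  have hG₀ := hβ₀.comp (-discInversionFun z₀) (hN₀.comp (-discInversionFun z₀) hsc)
  have hnear : HasFDerivAt discNear ((fderiv ℝ blowDown (mobN ((4 : ℝ)⁻¹ • (-discInversionFun z₀)))).comp
      ((fderiv ℝ mobN ((4 : ℝ)⁻¹ • (-discInversionFun z₀))).comp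
        ((4 : ℝ)⁻¹ • ContinuousLinearMap.id ℝ (EuclideanSpace ℝ (Fin 3))))) (-discInversionFun z₀) := by
    refine hG₀.congr_of_eventuallyEq ?_
    filter_upwards [(isOpen_lt continuous_norm continuous_const).mem_nhds
      (show ‖-discInversionFun z₀‖ < (1 : ℝ) by rw [hnx₀']; norm_num)] with x hx
    exact discNear_of_norm_le hx.le
  have hT₀c := hnear.comp z₀ hD₀.neg
  have hT₀' : HasFDerivAt (fun z => discNear (-discInversionFun z))
      (((fderiv ℝ blowDown (mobN ((4 : ℝ)⁻¹ • (-discInversionFun z₀)))).comp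
        ((fderiv ℝ mobN ((4 : ℝ)⁻¹ • (-discInversionFun z₀))).comp
          ((4 : ℝ)⁻¹ • ContinuousLinearMap.id ℝ (EuclideanSpace ℝ (Fin 3))))).comp
        (-fderiv ℝ discInversionFun z₀)) z₀ := hT₀c
  -- the far transition map: `T₁ = β̂⁻¹ ∘ farMob ∘ r ∘ ι` near `z₁`
  have hD₁ := (differentiableAt_discInversionFun hz₁0).hasFDerivAt
  have hnv₁ : ‖r (discInversionFun z₁)‖ = δ' := by
    rw [LinearIsometryEquiv.norm_map, hι₁, norm_smul, hu₀, mul_one, Real.norm_of_nonneg hδ'pos.le]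
  have hr' : HasFDerivAt (⇑r) (r.toContinuousLinearEquiv : EuclideanSpace ℝ (Fin 3) →L[ℝ] EuclideanSpace ℝ (Fin 3))
      (discInversionFun z₁) := r.toContinuousLinearEquiv.hasFDerivAt
  have hF₁ := ((contDiffAt_farMob (show ‖r (discInversionFun z₁)‖ < 16 / 3 by rw [hnv₁]; linarith)).differentiableAt
    (by simp)).hasFDerivAt
  have hβ₁ := ((contDiff_blowDown.differentiable (by simp)) (farMob (r (discInversionFun z₁)))).hasFDerivAt
  have hG₁ := hβ₁.comp (r (discInversionFun z₁)) hF₁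
  have hfarD : HasFDerivAt discFar ((fderiv ℝ blowDown (farMob (r (discInversionFun z₁)))).comp
      (fderiv ℝ farMob (r (discInversionFun z₁)))) (r (discInversionFun z₁)) := by
    refine hG₁.congr_of_eventuallyEq ?_
    filter_upwards [(isOpen_lt continuous_norm continuous_const).mem_nhds
      (show ‖r (discInversionFun z₁)‖ < (1 : ℝ) by rw [hnv₁]; linarith)] with x hx
    exact discFar_of_norm_le hx.le
  have hT₁c := hfarD.comp z₁ (hr'.comp z₁ hD₁)
  have hT₁' : HasFDerivAt (fun z => discFar (r (discInversionFun z)))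
      (((fderiv ℝ blowDown (farMob (r (discInversionFun z₁)))).comp
        (fderiv ℝ farMob (r (discInversionFun z₁)))).comp
        ((r.toContinuousLinearEquiv : EuclideanSpace ℝ (Fin 3) →L[ℝ] EuclideanSpace ℝ (Fin 3)).comp
          (fderiv ℝ discInversionFun z₁))) z₁ := hT₁c
  -- the signs of the factors
  have hμ₀ := det_fderiv_mobN_neg hv₀q
  have hι₀d := det_fderiv_discInversionFun_neg_three hz₀0 hz₀1
  have hι₁d := det_fderiv_discInversionFun_neg_three hz₁0 hz₁1
  have hφ₁ : 0 < LinearMap.det ((fderiv ℝ farMob (r (discInversionFun z₁)) :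
      EuclideanSpace ℝ (Fin 3) →L[ℝ] EuclideanSpace ℝ (Fin 3)) : EuclideanSpace ℝ (Fin 3) →ₗ[ℝ] EuclideanSpace ℝ (Fin 3)) :=
    hfar (by rw [dist_zero_right, hnv₁]; exact hδ'lt)
  have hrdet : LinearMap.det ((r.toContinuousLinearEquiv : EuclideanSpace ℝ (Fin 3) →L[ℝ] EuclideanSpace ℝ (Fin 3)) :
      EuclideanSpace ℝ (Fin 3) →ₗ[ℝ] EuclideanSpace ℝ (Fin 3)) < 0 := hr
  have hββ := det_fderiv_blowDown_mul_pos (mobN ((4 : ℝ)⁻¹ • (-discInversionFun z₀))) (farMob (r (discInversionFun z₁)))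
  -- assemble
  set β₀ := LinearMap.det ((fderiv ℝ blowDown (mobN ((4 : ℝ)⁻¹ • (-discInversionFun z₀))) :
      EuclideanSpace ℝ (Fin 3) →L[ℝ] EuclideanSpace ℝ (Fin 3)) : EuclideanSpace ℝ (Fin 3) →ₗ[ℝ] EuclideanSpace ℝ (Fin 3))
  set β₁ := LinearMap.det ((fderiv ℝ blowDown (farMob (r (discInversionFun z₁))) :
      EuclideanSpace ℝ (Fin 3) →L[ℝ] EuclideanSpace ℝ (Fin 3)) : EuclideanSpace ℝ (Fin 3) →ₗ[ℝ] EuclideanSpace ℝ (Fin 3))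
  set μ₀ := LinearMap.det ((fderiv ℝ mobN ((4 : ℝ)⁻¹ • (-discInversionFun z₀)) :
      EuclideanSpace ℝ (Fin 3) →L[ℝ] EuclideanSpace ℝ (Fin 3)) : EuclideanSpace ℝ (Fin 3) →ₗ[ℝ] EuclideanSpace ℝ (Fin 3))
  set d₀ := LinearMap.det ((fderiv ℝ discInversionFun z₀ :
      EuclideanSpace ℝ (Fin 3) →L[ℝ] EuclideanSpace ℝ (Fin 3)) : EuclideanSpace ℝ (Fin 3) →ₗ[ℝ] EuclideanSpace ℝ (Fin 3))
  set d₁ := LinearMap.det ((fderiv ℝ discInversionFun z₁ :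
      EuclideanSpace ℝ (Fin 3) →L[ℝ] EuclideanSpace ℝ (Fin 3)) : EuclideanSpace ℝ (Fin 3) →ₗ[ℝ] EuclideanSpace ℝ (Fin 3))
  set φ₁ := LinearMap.det ((fderiv ℝ farMob (r (discInversionFun z₁)) :
      EuclideanSpace ℝ (Fin 3) →L[ℝ] EuclideanSpace ℝ (Fin 3)) : EuclideanSpace ℝ (Fin 3) →ₗ[ℝ] EuclideanSpace ℝ (Fin 3))
  set ρ := LinearMap.det ((r.toContinuousLinearEquiv : EuclideanSpace ℝ (Fin 3) →L[ℝ] EuclideanSpace ℝ (Fin 3)) :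
      EuclideanSpace ℝ (Fin 3) →ₗ[ℝ] EuclideanSpace ℝ (Fin 3))
  have e₀ : LinearMap.det ((fderiv ℝ (fun z => discNear (-discInversionFun z)) z₀ :
      EuclideanSpace ℝ (Fin 3) →L[ℝ] EuclideanSpace ℝ (Fin 3)) : EuclideanSpace ℝ (Fin 3) →ₗ[ℝ] EuclideanSpace ℝ (Fin 3)) =
      β₀ * (μ₀ * ((4 : ℝ)⁻¹ ^ 3 * -d₀)) := by
    rw [hT₀'.fderiv]
    simp only [det_coe_comp_three, det_smul_id_clm, det_neg_clm]
    ring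
  have e₁ : LinearMap.det ((fderiv ℝ (fun z => discFar (r (discInversionFun z))) z₁ :
      EuclideanSpace ℝ (Fin 3) →L[ℝ] EuclideanSpace ℝ (Fin 3)) : EuclideanSpace ℝ (Fin 3) →ₗ[ℝ] EuclideanSpace ℝ (Fin 3)) =
      β₁ * (φ₁ * (ρ * d₁)) := by
    rw [hT₁'.fderiv]
    simp only [det_coe_comp_three]
    ring
  have hiff' : (0 < LinearMap.det ((fderiv ℝ (fun z => discNear (-discInversionFun z)) z₀ :
      EuclideanSpace ℝ (Fin 3) →L[ℝ] EuclideanSpace ℝ (Fin 3)) : EuclideanSpace ℝ (Fin 3) →ₗ[ℝ] EuclideanSpace ℝ (Fin 3))) ↔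
      0 < LinearMap.det ((fderiv ℝ (fun z => discFar (r (discInversionFun z))) z₁ :
      EuclideanSpace ℝ (Fin 3) →L[ℝ] EuclideanSpace ℝ (Fin 3)) : EuclideanSpace ℝ (Fin 3) →ₗ[ℝ] EuclideanSpace ℝ (Fin 3)) :=
    hiff
  rw [e₀, e₁] at hiff'
  clear hiff
  -- `ℓ₀ = β₀ (μ₀ (4⁻³ (-d₀)))` is `β₀ ·` NEGATIVE, `ℓ₁ = β₁ φ₁ (ρ d₁)` is `β₁ ·` POSITIVE, and `β₀ β₁ > 0`
  have hn₀ : μ₀ * ((4 : ℝ)⁻¹ ^ 3 * -d₀) < 0 := mul_neg_of_neg_of_pos hμ₀ (by nlinarith)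
  have hp₁ : 0 < φ₁ * (ρ * d₁) := mul_pos hφ₁ (mul_pos_of_neg_of_neg hrdet hι₁d)
  rcases pos_and_pos_or_neg_and_neg_of_mul_pos hββ with ⟨hb₀, hb₁⟩ | ⟨hb₀, hb₁⟩
  · have h1 : β₀ * (μ₀ * ((4 : ℝ)⁻¹ ^ 3 * -d₀)) < 0 := mul_neg_of_pos_of_neg hb₀ hn₀
    have h2 : 0 < β₁ * (φ₁ * (ρ * d₁)) := mul_pos hb₁ hp₁
    exact absurd (hiff'.2 h2) (not_lt.2 h1.le)
  · have h1 : 0 < β₀ * (μ₀ * ((4 : ℝ)⁻¹ ^ 3 * -d₀)) := mul_pos_of_neg_of_neg hb₀ hn₀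
    have h2 : β₁ * (φ₁ * (ρ * d₁)) < 0 := mul_neg_of_neg_of_pos hb₁ hp₁
    exact absurd (hiff'.1 h1) (not_lt.2 h2.le)

end ZeroSphereModel

end Literature.Topology.FourManifolds
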